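import Literature.NumberTheory.EllipticCurves.FormalGroupLubinTateDivisionPointsTateUnit
import Literature.NumberTheory.GaloisRepresentations.LubinTateTateModuleGeneratorUnique
import HarnessLib

/-!
# The Tate-module unit of `exists_unit_forall_ptOfZ_hom_hom_cohPt_eq` is UNIQUE, and MOVES BY `c` when the points move by `[c]_{V̂}`
# (de Shalit II §4.3–4.4: «`Ω_p` is uniquely determined modulo `𝒪_𝔭ˣ`» — proofs only)

Topic `NumberTheory/EllipticCurves` (theorems only; no definition, no named fact, no instance).  Cell `bsd-print-cf2`, width seat
`bsd-line-cf2-p1-w2` g25, piece TATE-UNIT-LT (the Lubin–Tate half of -w8 g13's «TATE-UNIT-CM», finding OQ-A1): the unit `a` of brick B10a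
(`FormalGroupLubinTateDivisionPointsTateUnit.exists_unit_forall_ptOfZ_hom_hom_cohPt_eq`: `P(h([a]_f ω_{n+1})) = U_n` for all `n`,
`h = [1]_{P′,f}`) is pinned by the points `U_n`, and two systems of points whose PARAMETERS differ by the Lubin–Tate action `[c]_{P′}` of the
curve's formal group have units differing by the factor `c`.  In the lane `V̂ = F_{P′}` carries de Shalit's `p`-adic period: this is
II §4.3's «`Ω_p` is uniquely determined modulo `𝒪_𝔭ˣ`» together with its covariance — across chain levels `M` the base points
`Ω_E/(μ_M π₀ⁿ)` move by the CM action `[μ_M⁻¹]`, read on parameters as `[e(μ_M)⁻¹]_{P′}`, so `a_M = e(μ_M)⁻¹·a_0` once the CM half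
(«algebraic `[μ]` on `E₁`-readings = `[e μ]_{P′}` on parameters», `CMFormalActionLaneCoherence`) is supplied by the consumer.

* ★ `unit_eq_of_forall_ptOfZ_hom_hom_cohPt_eq` — UNIQUENESS: two units serving the same points coincide (`ptOfZ_injective`,
  `[1]_{f,P′} ∘ [1]_{P′,f} = id` (`evalPt₁_hom_one_evalPt₁_hom_one`), naturality `inclUnitBall_ltSMul`, and the Tate-module uniqueness
  `unit_eq_of_forall_coe_ltAct_cohPt_eq`);
* ★ `forall_ptOfZ_hom_hom_cohPt_eq_of_zPt_eq_ltSMul` — TRANSPORT: if `a` serves `U` and `z(U′_n) = [c]_{P′} z(U_n)` for all `n`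
  (`c ∈ 𝒪_F`), then `c·a` serves `U′` (`mul_ltSMul`, the intertwining `ltSMul_evalPt₁_hom_one`, `eq_ptOfZ_zPt`);
* ★ `unit_eq_mul_of_zPt_eq_ltSMul` — COVARIANCE: if `a` serves `U`, `a′` serves `U′` and `z(U′_n) = [c]_{P′} z(U_n)` with `c ∈ 𝒪_Fˣ`, then
  `a′ = c·a`.

No summit statement is proved; BSD is not proved by any of this.

## References
* [deShalit1987] E. de Shalit, *Iwasawa theory of elliptic curves with complex multiplication* (1987), II §4.3 (p. 57: «uniquely determined
  modulo `𝒪_𝔭ˣ`»), II §4.4 (11)–(12), (iii)–(iv).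
* [CasselsFrohlichANT1967] J.-P. Serre, *Local class field theory* (Cassels–Fröhlich Ch. VI), §3.6 Prop. 6.
* [LubinTate1965] J. Lubin, J. Tate, Ann. of Math. 81 (1965), §1 Thm. 1, Thm. 2.
-/

noncomputable section

open scoped Classical
open PowerSeries

namespace Literature.NumberTheory.EllipticCurves

open ValuativeRel Literature.NumberTheory.GaloisRepresentations
  Literature.NumberTheory.GaloisRepresentations.IsNonarchimedeanLocalField
  Literature.NumberTheory.GaloisRepresentations.LubinTate
open Literature.NumberTheory.EllipticCurves.FormalGroupChart _root_.WeierstrassCurve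

section TateUnitUnique

variable {F : Type} [Field F] [ValuativeRel F] [TopologicalSpace F] [IsNonarchimedeanLocalField F]

attribute [local instance] ltNormUniformSpace ltNormIsUniformAddGroup rk1 nF nE fintypeResidueField

variable {p : ℕ} [Fact p.Prime] (e : 𝒪[F] ≃+* ℤ_[p]) (hq : residueFieldCard F = p)
  {π : 𝒪[F]} (hπ : (valuation F).IsUniformizer (π : F)) {πZ : ℤ_[p]} (he : e π = πZ)
  {P : PowerSeries ℤ_[p]} (hP : IsLTSeries πZ p P) (V : WeierstrassCurve ℤ_[p])
  (E : IntermediateField F (AlgebraicClosure F)) [FiniteDimensional F E]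

set_option maxHeartbeats 800000 in
/-- ★ **UNIQUENESS of the Tate-module unit**: if `a, b ∈ 𝒪_Fˣ` both satisfy `P(h([·]_f ω_{n+1})) = U_n` for all `n` (the conclusion of
`exists_unit_forall_ptOfZ_hom_hom_cohPt_eq`, same points `U_n`), then `a = b` — de Shalit II §4.3 «`Ω_p` is uniquely determined modulo `𝒪_𝔭ˣ`»:
the points determine the unit.  Proof: `P` is injective on parameters, `[1]_{f,P′}` undoes `h = [1]_{P′,f}`, the inclusion
`𝔪_{K_π^{n+1}} ⊆ 𝔪_{M_n}` commutes with `[·]_f`, and a unit is determined by its action on the generator `(ω_n)` of the Tate module.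
[cite: deShalit1987, II §4.3 (p. 57), II §4.4 (iii)–(iv)] [cite: CasselsFrohlichANT1967, Ch. VI §3.6 Prop. 6] -/
theorem unit_eq_of_forall_ptOfZ_hom_hom_cohPt_eq
    [hEll : ∀ n : ℕ, (curveOver (E ⊔ ltField π n : IntermediateField F (AlgebraicClosure F))
      (V.map ((LTCoeff.of F).toRingHom.comp e.symm.toRingHom))).IsElliptic]
    (U : ∀ n : ℕ, (curveOver (E ⊔ ltField π n : IntermediateField F (AlgebraicClosure F))
      (V.map ((LTCoeff.of F).toRingHom.comp e.symm.toRingHom))).toAffine.Point)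
    {a b : 𝒪[F]ˣ}
    (ha : ∀ n : ℕ,
      ptOfZ (E ⊔ ltField π n : IntermediateField F (AlgebraicClosure F)) (V.map ((LTCoeff.of F).toRingHom.comp e.symm.toRingHom))
        (evalPt₁ (maxNilIdeal F (E ⊔ ltField π n : IntermediateField F (AlgebraicClosure F)))
          (hom (isLTRing_LTCoeff hπ) (isLTSeries_map_LTCoeff_of_degree_one e hq he hP) (isLTSeries_LTCoeff π) 1)
          (constantCoeff_hom _ _ _ 1)
          (evalPt₁ (maxNilIdeal F (E ⊔ ltField π n : IntermediateField F (AlgebraicClosure F)))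
            (hom (isLTRing_LTCoeff hπ) (isLTSeries_LTCoeff π) (isLTSeries_LTCoeff π) (LTCoeff.of F (a : 𝒪[F])))
            (constantCoeff_hom _ _ _ _)
            (inclPt (le_sup_right : ltField π n ≤ E ⊔ ltField π n) (cohPt hπ n)))) = U n)
    (hb : ∀ n : ℕ,
      ptOfZ (E ⊔ ltField π n : IntermediateField F (AlgebraicClosure F)) (V.map ((LTCoeff.of F).toRingHom.comp e.symm.toRingHom))
        (evalPt₁ (maxNilIdeal F (E ⊔ ltField π n : IntermediateField F (AlgebraicClosure F)))
          (hom (isLTRing_LTCoeff hπ) (isLTSeries_map_LTCoeff_of_degree_one e hq he hP) (isLTSeries_LTCoeff π) 1)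
          (constantCoeff_hom _ _ _ 1)
          (evalPt₁ (maxNilIdeal F (E ⊔ ltField π n : IntermediateField F (AlgebraicClosure F)))
            (hom (isLTRing_LTCoeff hπ) (isLTSeries_LTCoeff π) (isLTSeries_LTCoeff π) (LTCoeff.of F (b : 𝒪[F])))
            (constantCoeff_hom _ _ _ _)
            (inclPt (le_sup_right : ltField π n ≤ E ⊔ ltField π n) (cohPt hπ n)))) = U n) :
    a = b := by
  have hP' := isLTSeries_map_LTCoeff_of_degree_one e hq he hP
  refine unit_eq_of_forall_coe_ltAct_cohPt_eq hπ fun n => ?_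
  -- `[a]_f ω' = [b]_f ω'` in `𝔪_{M_n}` (`ω' = ι ω_{n+1}`): strip `P` and `h`
  have h1 := ptOfZ_injective ((ha n).trans (hb n).symm)
  have h2 := congrArg (evalPt₁ (maxNilIdeal F (E ⊔ ltField π n : IntermediateField F (AlgebraicClosure F)))
    (hom (isLTRing_LTCoeff hπ) (isLTSeries_LTCoeff π) hP' 1) (constantCoeff_hom _ _ _ 1)) h1
  rw [evalPt₁_hom_one_evalPt₁_hom_one (M := maxNilIdeal F (E ⊔ ltField π n : IntermediateField F (AlgebraicClosure F)))
      (hA := isLTRing_LTCoeff hπ) (hf := isLTSeries_LTCoeff π) (hg := hP'),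
    evalPt₁_hom_one_evalPt₁_hom_one (M := maxNilIdeal F (E ⊔ ltField π n : IntermediateField F (AlgebraicClosure F)))
      (hA := isLTRing_LTCoeff hπ) (hf := isLTSeries_LTCoeff π) (hg := hP')] at h2
  -- `h2 : [a]_f ω' = [b]_f ω'` in `𝔪_{M_n}`; read it in `F̄` and move `[·]_f` inside `K_π^{n+1}` along the inclusion
  have e1 := inclUnitBall_ltSMul (le_sup_right : ltField π n ≤ E ⊔ ltField π n) (hA := isLTRing_LTCoeff hπ)
    (LTCoeff.of F (a : 𝒪[F])) (cohPt hπ n)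
  have e2 := inclUnitBall_ltSMul (le_sup_right : ltField π n ≤ E ⊔ ltField π n) (hA := isLTRing_LTCoeff hπ)
    (LTCoeff.of F (b : 𝒪[F])) (cohPt hπ n)
  have h3 := congrArg (fun y : (maxNilIdeal F (E ⊔ ltField π n : IntermediateField F (AlgebraicClosure F))).toIdeal =>
    (((y : unitBall (E ⊔ ltField π n : IntermediateField F (AlgebraicClosure F))) :
      (E ⊔ ltField π n : IntermediateField F (AlgebraicClosure F))) : AlgebraicClosure F)) h2
  change ((((ltSMul (maxNilIdeal F (E ⊔ ltField π n : IntermediateField F (AlgebraicClosure F))) (isLTRing_LTCoeff hπ)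
        (isLTSeries_LTCoeff π) (LTCoeff.of F (a : 𝒪[F])) (inclPt (le_sup_right : ltField π n ≤ E ⊔ ltField π n) (cohPt hπ n)) :
        (maxNilIdeal F (E ⊔ ltField π n : IntermediateField F (AlgebraicClosure F))).toIdeal) :
        unitBall (E ⊔ ltField π n : IntermediateField F (AlgebraicClosure F))) :
        (E ⊔ ltField π n : IntermediateField F (AlgebraicClosure F))) : AlgebraicClosure F) =
      ((((ltSMul (maxNilIdeal F (E ⊔ ltField π n : IntermediateField F (AlgebraicClosure F))) (isLTRing_LTCoeff hπ)
        (isLTSeries_LTCoeff π) (LTCoeff.of F (b : 𝒪[F])) (inclPt (le_sup_right : ltField π n ≤ E ⊔ ltField π n) (cohPt hπ n)) :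
        (maxNilIdeal F (E ⊔ ltField π n : IntermediateField F (AlgebraicClosure F))).toIdeal) :
        unitBall (E ⊔ ltField π n : IntermediateField F (AlgebraicClosure F))) :
        (E ⊔ ltField π n : IntermediateField F (AlgebraicClosure F))) : AlgebraicClosure F) at h3
  rw [← e1, ← e2] at h3
  exact h3

set_option maxHeartbeats 800000 in
/-- ★ **TRANSPORT of the Tate-module unit along the Lubin–Tate action**: if `a ∈ 𝒪_F` serves the points `U_n` (`P(h([a]_f ω_{n+1})) = U_n`)
and the parameters of the points `U′_n` are the `[c]_{P′}`-translates of those of `U_n` (`z(U′_n) = [c]_{P′} z(U_n)`, `c ∈ 𝒪_F`;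
`P′ = V̂`'s Lubin–Tate endomorphisms), then `c·a` serves `U′_n`: `P(h([c·a]_f ω_{n+1})) = U′_n` — because `[c·a]_f = [c]_f ∘ [a]_f` and
`h ∘ [c]_f = [c]_{P′} ∘ h`. [cite: deShalit1987, II §4.4 (11)–(12), (iv)] [cite: LubinTate1965, §1 Thm. 1 (10)–(12)] -/
theorem forall_ptOfZ_hom_hom_cohPt_eq_of_zPt_eq_ltSMul
    [hEll : ∀ n : ℕ, (curveOver (E ⊔ ltField π n : IntermediateField F (AlgebraicClosure F))
      (V.map ((LTCoeff.of F).toRingHom.comp e.symm.toRingHom))).IsElliptic]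
    (U U' : ∀ n : ℕ, (curveOver (E ⊔ ltField π n : IntermediateField F (AlgebraicClosure F))
      (V.map ((LTCoeff.of F).toRingHom.comp e.symm.toRingHom))).toAffine.Point)
    (hU : ∀ n : ℕ, U n ∈ kernel (NormedField.valuation (K := (E ⊔ ltField π n : IntermediateField F (AlgebraicClosure F))))
      (curveOver (E ⊔ ltField π n : IntermediateField F (AlgebraicClosure F)) (V.map ((LTCoeff.of F).toRingHom.comp e.symm.toRingHom))))
    (hU' : ∀ n : ℕ, U' n ∈ kernel (NormedField.valuation (K := (E ⊔ ltField π n : IntermediateField F (AlgebraicClosure F))))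
      (curveOver (E ⊔ ltField π n : IntermediateField F (AlgebraicClosure F)) (V.map ((LTCoeff.of F).toRingHom.comp e.symm.toRingHom))))
    {a : 𝒪[F]}
    (ha : ∀ n : ℕ,
      ptOfZ (E ⊔ ltField π n : IntermediateField F (AlgebraicClosure F)) (V.map ((LTCoeff.of F).toRingHom.comp e.symm.toRingHom))
        (evalPt₁ (maxNilIdeal F (E ⊔ ltField π n : IntermediateField F (AlgebraicClosure F)))
          (hom (isLTRing_LTCoeff hπ) (isLTSeries_map_LTCoeff_of_degree_one e hq he hP) (isLTSeries_LTCoeff π) 1)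
          (constantCoeff_hom _ _ _ 1)
          (evalPt₁ (maxNilIdeal F (E ⊔ ltField π n : IntermediateField F (AlgebraicClosure F)))
            (hom (isLTRing_LTCoeff hπ) (isLTSeries_LTCoeff π) (isLTSeries_LTCoeff π) (LTCoeff.of F a))
            (constantCoeff_hom _ _ _ _)
            (inclPt (le_sup_right : ltField π n ≤ E ⊔ ltField π n) (cohPt hπ n)))) = U n)
    (c : 𝒪[F])
    (hc : ∀ n : ℕ, zPt (U' n) (hU' n) =
      ltSMul (maxNilIdeal F (E ⊔ ltField π n : IntermediateField F (AlgebraicClosure F))) (isLTRing_LTCoeff hπ)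
        (isLTSeries_map_LTCoeff_of_degree_one e hq he hP) (LTCoeff.of F c) (zPt (U n) (hU n))) :
    ∀ n : ℕ,
      ptOfZ (E ⊔ ltField π n : IntermediateField F (AlgebraicClosure F)) (V.map ((LTCoeff.of F).toRingHom.comp e.symm.toRingHom))
        (evalPt₁ (maxNilIdeal F (E ⊔ ltField π n : IntermediateField F (AlgebraicClosure F)))
          (hom (isLTRing_LTCoeff hπ) (isLTSeries_map_LTCoeff_of_degree_one e hq he hP) (isLTSeries_LTCoeff π) 1)
          (constantCoeff_hom _ _ _ 1)
          (evalPt₁ (maxNilIdeal F (E ⊔ ltField π n : IntermediateField F (AlgebraicClosure F)))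
            (hom (isLTRing_LTCoeff hπ) (isLTSeries_LTCoeff π) (isLTSeries_LTCoeff π) (LTCoeff.of F (c * a)))
            (constantCoeff_hom _ _ _ _)
            (inclPt (le_sup_right : ltField π n ≤ E ⊔ ltField π n) (cohPt hπ n)))) = U' n := by
  have hP' := isLTSeries_map_LTCoeff_of_degree_one e hq he hP
  intro n
  -- the parameter of `U_n` is `h([a]_f ω')`
  have ht : evalPt₁ (maxNilIdeal F (E ⊔ ltField π n : IntermediateField F (AlgebraicClosure F)))
      (hom (isLTRing_LTCoeff hπ) hP' (isLTSeries_LTCoeff π) 1) (constantCoeff_hom _ _ _ 1)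
      (evalPt₁ (maxNilIdeal F (E ⊔ ltField π n : IntermediateField F (AlgebraicClosure F)))
        (hom (isLTRing_LTCoeff hπ) (isLTSeries_LTCoeff π) (isLTSeries_LTCoeff π) (LTCoeff.of F a)) (constantCoeff_hom _ _ _ _)
        (inclPt (le_sup_right : ltField π n ≤ E ⊔ ltField π n) (cohPt hπ n))) = zPt (U n) (hU n) :=
    ptOfZ_injective ((ha n).trans (eq_ptOfZ_zPt (hU n)))
  -- `h([c·a]_f ω') = [c]_{P′} h([a]_f ω') = [c]_{P′} z(U_n) = z(U′_n)`
  have hX : evalPt₁ (maxNilIdeal F (E ⊔ ltField π n : IntermediateField F (AlgebraicClosure F)))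
      (hom (isLTRing_LTCoeff hπ) hP' (isLTSeries_LTCoeff π) 1) (constantCoeff_hom _ _ _ 1)
      (evalPt₁ (maxNilIdeal F (E ⊔ ltField π n : IntermediateField F (AlgebraicClosure F)))
        (hom (isLTRing_LTCoeff hπ) (isLTSeries_LTCoeff π) (isLTSeries_LTCoeff π) (LTCoeff.of F (c * a))) (constantCoeff_hom _ _ _ _)
        (inclPt (le_sup_right : ltField π n ≤ E ⊔ ltField π n) (cohPt hπ n))) =
      ltSMul (maxNilIdeal F (E ⊔ ltField π n : IntermediateField F (AlgebraicClosure F))) (isLTRing_LTCoeff hπ) hP'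
        (LTCoeff.of F c) (zPt (U n) (hU n)) := by
    rw [← ht, ltSMul_evalPt₁_hom_one (M := maxNilIdeal F (E ⊔ ltField π n : IntermediateField F (AlgebraicClosure F)))
      (hA := isLTRing_LTCoeff hπ) (hg := hP') (hf := isLTSeries_LTCoeff π)]
    congr 1
    change ltSMul (maxNilIdeal F (E ⊔ ltField π n : IntermediateField F (AlgebraicClosure F))) (isLTRing_LTCoeff hπ)
        (isLTSeries_LTCoeff π) (LTCoeff.of F (c * a)) (inclPt (le_sup_right : ltField π n ≤ E ⊔ ltField π n) (cohPt hπ n)) =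
      ltSMul (maxNilIdeal F (E ⊔ ltField π n : IntermediateField F (AlgebraicClosure F))) (isLTRing_LTCoeff hπ)
        (isLTSeries_LTCoeff π) (LTCoeff.of F c)
        (ltSMul (maxNilIdeal F (E ⊔ ltField π n : IntermediateField F (AlgebraicClosure F))) (isLTRing_LTCoeff hπ)
          (isLTSeries_LTCoeff π) (LTCoeff.of F a) (inclPt (le_sup_right : ltField π n ≤ E ⊔ ltField π n) (cohPt hπ n)))
    rw [map_mul, mul_ltSMul]
  rw [hX, ← hc n]
  exact (eq_ptOfZ_zPt (hU' n)).symm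

set_option maxHeartbeats 800000 in
/-- ★ **COVARIANCE of the Tate-module unit** (II §4.3 «modulo `𝒪_𝔭ˣ`», made precise): if `a` serves `U_n`, `a′` serves `U′_n`, and
`z(U′_n) = [c]_{P′} z(U_n)` for a unit `c ∈ 𝒪_Fˣ`, then `a′ = c·a`.  In the lane: the points of two chain levels differ by the CM action of
the v-adic unit `μ` (`[μ]` on `E₁`-readings `= [e μ]_{P′}` on parameters — the consumer's input), so their Tate units differ by `e μ`.
[cite: deShalit1987, II §4.3 (p. 57), II §4.4 (11)–(12), (iii)–(iv)] [cite: CasselsFrohlichANT1967, Ch. VI §3.6 Prop. 6] -/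
theorem unit_eq_mul_of_zPt_eq_ltSMul
    [hEll : ∀ n : ℕ, (curveOver (E ⊔ ltField π n : IntermediateField F (AlgebraicClosure F))
      (V.map ((LTCoeff.of F).toRingHom.comp e.symm.toRingHom))).IsElliptic]
    (U U' : ∀ n : ℕ, (curveOver (E ⊔ ltField π n : IntermediateField F (AlgebraicClosure F))
      (V.map ((LTCoeff.of F).toRingHom.comp e.symm.toRingHom))).toAffine.Point)
    (hU : ∀ n : ℕ, U n ∈ kernel (NormedField.valuation (K := (E ⊔ ltField π n : IntermediateField F (AlgebraicClosure F))))
      (curveOver (E ⊔ ltField π n : IntermediateField F (AlgebraicClosure F)) (V.map ((LTCoeff.of F).toRingHom.comp e.symm.toRingHom))))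
    (hU' : ∀ n : ℕ, U' n ∈ kernel (NormedField.valuation (K := (E ⊔ ltField π n : IntermediateField F (AlgebraicClosure F))))
      (curveOver (E ⊔ ltField π n : IntermediateField F (AlgebraicClosure F)) (V.map ((LTCoeff.of F).toRingHom.comp e.symm.toRingHom))))
    {a a' : 𝒪[F]ˣ}
    (ha : ∀ n : ℕ,
      ptOfZ (E ⊔ ltField π n : IntermediateField F (AlgebraicClosure F)) (V.map ((LTCoeff.of F).toRingHom.comp e.symm.toRingHom))
        (evalPt₁ (maxNilIdeal F (E ⊔ ltField π n : IntermediateField F (AlgebraicClosure F)))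
          (hom (isLTRing_LTCoeff hπ) (isLTSeries_map_LTCoeff_of_degree_one e hq he hP) (isLTSeries_LTCoeff π) 1)
          (constantCoeff_hom _ _ _ 1)
          (evalPt₁ (maxNilIdeal F (E ⊔ ltField π n : IntermediateField F (AlgebraicClosure F)))
            (hom (isLTRing_LTCoeff hπ) (isLTSeries_LTCoeff π) (isLTSeries_LTCoeff π) (LTCoeff.of F (a : 𝒪[F])))
            (constantCoeff_hom _ _ _ _)
            (inclPt (le_sup_right : ltField π n ≤ E ⊔ ltField π n) (cohPt hπ n)))) = U n)
    (ha' : ∀ n : ℕ,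
      ptOfZ (E ⊔ ltField π n : IntermediateField F (AlgebraicClosure F)) (V.map ((LTCoeff.of F).toRingHom.comp e.symm.toRingHom))
        (evalPt₁ (maxNilIdeal F (E ⊔ ltField π n : IntermediateField F (AlgebraicClosure F)))
          (hom (isLTRing_LTCoeff hπ) (isLTSeries_map_LTCoeff_of_degree_one e hq he hP) (isLTSeries_LTCoeff π) 1)
          (constantCoeff_hom _ _ _ 1)
          (evalPt₁ (maxNilIdeal F (E ⊔ ltField π n : IntermediateField F (AlgebraicClosure F)))
            (hom (isLTRing_LTCoeff hπ) (isLTSeries_LTCoeff π) (isLTSeries_LTCoeff π) (LTCoeff.of F (a' : 𝒪[F])))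
            (constantCoeff_hom _ _ _ _)
            (inclPt (le_sup_right : ltField π n ≤ E ⊔ ltField π n) (cohPt hπ n)))) = U' n)
    (c : 𝒪[F]ˣ)
    (hc : ∀ n : ℕ, zPt (U' n) (hU' n) =
      ltSMul (maxNilIdeal F (E ⊔ ltField π n : IntermediateField F (AlgebraicClosure F))) (isLTRing_LTCoeff hπ)
        (isLTSeries_map_LTCoeff_of_degree_one e hq he hP) (LTCoeff.of F (c : 𝒪[F])) (zPt (U n) (hU n))) :
    a' = c * a := by
  refine unit_eq_of_forall_ptOfZ_hom_hom_cohPt_eq e hq hπ he hP V E U' ha' fun n => ?_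
  rw [Units.val_mul]
  exact forall_ptOfZ_hom_hom_cohPt_eq_of_zPt_eq_ltSMul e hq hπ he hP V E U U' hU hU' ha (c : 𝒪[F]) hc n

end TateUnitUnique

end Literature.NumberTheory.EllipticCurves

end
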